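import Summits.Ventures.QEC.Census.CertInfoSetOrbitFast
import Summits.Ventures.QEC.Census.CertCheckMitm
import Summits.Ventures.QEC.Census.CertCheckParityFast
import HarnessLib

/-!
# Orbit-averaged information-set lower bounds — soundness of the FAST lane and the certificate-level statements
# (qec-search-4 g4; companion of `Census/CertInfoSetOrbitFast.lean`)

`orbit_lower_soundF`: the hypotheses an emitted row proves by `decide +kernel` in the fast shape (type-12 `autGensOKFast`,
`autWordsOK`, per-view `infoSetStructOK` and replays, `orbitProfileOKF`) give the flat lower bound `wmax < |w|` for every
non-trivial logical — by `orbit_lower_sound_abs` applied to the INVERSES of the listed word automorphisms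
(`exists_submatrix_symm`), whose orbit multiplicities are the transported-mask counts (`testBit_wordApplyL_symm`,
`testBit_freeMaskOf`, `countMasks_eq`).  Then `DistCert.lowZ_of_orbitF` / `lowX_of_orbitF` / `dZ_code_of_orbitF` /
`dX_code_of_orbitF` (the shapes consumed by `isCode_of_onesided_lower` / `CSSCode.isCode_of_dX_dZ`), and the `[[4,2,2]]`
controls (positive, and a NEGATIVE profile).  HONEST FRAMING: no certificate is read here and no distance value is
asserted; tier KERNEL, axioms ⊆ {propext, Classical.choice, Quot.sound}; no `native_decide`.
-/

set_option autoImplicit false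

namespace Summit.Ventures.QEC.Census

open Matrix Literature.InformationTheory.QuantumCodes

/-! ## Soundness of the fast lane -/

section Fast

variable {n : ℕ} {Hsyn Hstab : List ℕ}

/-- **Soundness of the fast orbit lane (one side).**  The automorphisms averaged over are the INVERSES `σ_w⁻¹` of the
listed words (`exists_submatrix_symm`), whose multiplicities are exactly the transported-mask counts of `multTabOKF`. -/
theorem orbit_lower_soundF (hcomm : rowMatrix n Hsyn * (rowMatrix n Hstab)ᵀ = 0) {found : List (ℕ × List ℕ)}
    (hfound : foundOK Hstab found = true)
    {gens : List AutGen} (hgens : autGensOKFast n Hsyn Hstab gens = true)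
    {words : List (List ℕ)} (hwords : autWordsOK gens.length words = true)
    {views : List OrbitView}
    (hviews : ∀ s, s < views.length → infoSetStructOK n Hsyn (views.getD s dfltView).ic = true)
    {wmax : ℕ}
    (hreach : ∀ s, s < views.length → Reaches (bzLeaf wmax (found.map Prod.fst))
      (rowPos (kerBasis n (views.getD s dfltView).ic.piv (views.getD s dfltView).ic.red) 0)
      (views.getD s dfltView).t 0 0)
    {cls : List ℕ} {μ : List (List ℕ)}
    (hprof : orbitProfileOKF n wmax (autPerms gens) words views cls μ = true)
    (w : Fin n → ZMod 2) (hw : rowMatrix n Hsyn *ᵥ w = 0) (hw' : w ∉ rowSpace (rowMatrix n Hstab)) :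
    wmax < hammingNorm w := by
  have hgens' := autGensOK_of_fast hgens
  have hng : (autPerms gens).length = gens.length := List.length_map ..
  have hperm : ∀ g ∈ autPerms gens, permListOK n g = true := permListOK_of_autGensOK hgens'
  have hwd : ∀ i, i < words.length → ∀ g ∈ words.getD i [], g < (autPerms gens).length := fun i hi => by
    rw [hng, List.getD_eq_getElem?_getD, List.getElem?_eq_getElem hi, Option.getD_some]
    exact lt_of_autWordsOK hwords (List.getElem_mem hi)
  simp only [orbitProfileOKF, Bool.and_eq_true] at hprof
  obtain ⟨hmt, hgo⟩ := hprof
  simp only [multTabOKF, Bool.and_eq_true, beq_iff_eq, List.all_eq_true, List.mem_range, decide_eq_true_eq] at hmt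
  obtain ⟨⟨-, hcb⟩, hmt⟩ := hmt
  -- the abstract family: σ_i := (σ_{w_i})⁻¹
  let σ : ℕ → (Fin n ≃ Fin n) := fun i => (wordEquiv n (autPerms gens) (words.getD i [])).symm
  let f : ℕ → ℕ → ℕ := fun i x => if h : x < n then ((σ i ⟨x, h⟩ : Fin n) : ℕ) else 0
  refine orbit_lower_sound_abs hcomm hfound words.length σ f (fun i _ x => by simp [f, x.2]) ?_ ?_ hviews hreach
    (fun s x => countMasks (viewMasks n (autPerms gens) words (views.getD s dfltView).ic.piv) x) ?_ ?_ hgo w hw hw'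
  · intro i hi
    exact exists_submatrix_symm _ _ (exists_submatrix_eq_wordEquiv (H := Hsyn) hperm
      (rowMapOK_syn_of_autGensOK hgens') _ (hwd i hi))
  · intro i hi
    exact exists_submatrix_symm _ _ (exists_submatrix_eq_wordEquiv (H := Hstab) hperm
      (rowMapOK_stab_of_autGensOK hgens') _ (hwd i hi))
  · -- multiplicities: transported-mask counts = #{i : σ_i x free}
    intro s hs x
    rw [countMasks_eq]
    have hlen : (viewMasks n (autPerms gens) words (views.getD s dfltView).ic.piv).length = words.length := by
      rw [viewMasks, List.length_map]
    rw [hlen]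
    refine countB_congr _ _ _ fun i hi => ?_
    rw [List.mem_range] at hi
    have hwi := hwd i hi
    have hgi : words.getD i [] = words[i] := by
      rw [List.getD_eq_getElem?_getD, List.getElem?_eq_getElem hi, Option.getD_some]
    rw [hgi] at hwi
    rw [viewMasks, List.getD_eq_getElem?_getD, List.getElem?_map, List.getElem?_eq_getElem hi, Option.map_some,
      Option.getD_some, testBit_wordApplyL_symm hperm _ hwi _, testBit_freeMaskOf]
    simp only [f, σ, Fin.is_lt, dif_pos, Fin.eta, hgi]
  · intro x hx
    exact ⟨hcb x hx, fun s hs => (hmt s hs x hx)⟩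

end Fast

/-! ## The certificate-level statements (fast lane) -/

namespace DistCert

variable (c : DistCert)

/-- **`Z`-side lower bound from the fast orbit lane** (the `lowZ` hypothesis of `isCode_of_onesided_lower`). (theorem) -/
theorem lowZ_of_orbitF (hs : c.checkStructure = true) (o : OrbitSide)
    (hgens : autGensOKFast c.n c.HX c.HZ o.gens = true) (hwords : autWordsOK o.gens.length o.words = true)
    (hviews : ∀ s, s < o.views.length → infoSetStructOK c.n c.HX (o.views.getD s dfltView).ic = true)
    (hreach : ∀ s, s < o.views.length → Reaches (bzLeaf (c.dZ - 1) (c.sideZ.found.map Prod.fst))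
      (rowPos (kerBasis c.n (o.views.getD s dfltView).ic.piv (o.views.getD s dfltView).ic.red) 0)
      (o.views.getD s dfltView).t 0 0)
    (hprof : orbitProfileOKF c.n (c.dZ - 1) (autPerms o.gens) o.words o.views o.cls o.mu = true) :
    ∀ w : Fin c.n → ZMod 2, rowMatrix c.n c.HX *ᵥ w = 0 → w ∉ rowSpace (rowMatrix c.n c.HZ) →
      c.dZ - 1 < hammingNorm w := by
  have h' := hs
  simp only [checkStructure, Bool.and_eq_true] at h'
  exact orbit_lower_soundF (comm_of_commOK (c.commOK_of_checkStructure hs)) h'.1.1.2 hgens hwords hviews hreach hprof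

/-- **`X`-side lower bound from the fast orbit lane** (roles of `H^X`, `H^Z` exchanged). (theorem) -/
theorem lowX_of_orbitF (hs : c.checkStructure = true) (o : OrbitSide)
    (hgens : autGensOKFast c.n c.HZ c.HX o.gens = true) (hwords : autWordsOK o.gens.length o.words = true)
    (hviews : ∀ s, s < o.views.length → infoSetStructOK c.n c.HZ (o.views.getD s dfltView).ic = true)
    (hreach : ∀ s, s < o.views.length → Reaches (bzLeaf (c.dX - 1) (c.sideX.found.map Prod.fst))
      (rowPos (kerBasis c.n (o.views.getD s dfltView).ic.piv (o.views.getD s dfltView).ic.red) 0)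
      (o.views.getD s dfltView).t 0 0)
    (hprof : orbitProfileOKF c.n (c.dX - 1) (autPerms o.gens) o.words o.views o.cls o.mu = true) :
    ∀ w : Fin c.n → ZMod 2, rowMatrix c.n c.HZ *ᵥ w = 0 → w ∉ rowSpace (rowMatrix c.n c.HX) →
      c.dX - 1 < hammingNorm w := by
  have h' := hs
  simp only [checkStructure, Bool.and_eq_true] at h'
  have hcomm := comm_of_commOK (c.commOK_of_checkStructure hs)
  have hcomm' : rowMatrix c.n c.HZ * (rowMatrix c.n c.HX)ᵀ = 0 := by
    rw [← Matrix.transpose_transpose (rowMatrix c.n c.HZ), ← Matrix.transpose_mul, hcomm, Matrix.transpose_zero]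
  exact orbit_lower_soundF hcomm' h'.2 hgens hwords hviews hreach hprof

/-- **`d_Z` from the fast orbit lane.** (theorem) -/
theorem dZ_code_of_orbitF (hs : c.checkStructure = true) (o : OrbitSide)
    (hgens : autGensOKFast c.n c.HX c.HZ o.gens = true) (hwords : autWordsOK o.gens.length o.words = true)
    (hviews : ∀ s, s < o.views.length → infoSetStructOK c.n c.HX (o.views.getD s dfltView).ic = true)
    (hreach : ∀ s, s < o.views.length → Reaches (bzLeaf (c.dZ - 1) (c.sideZ.found.map Prod.fst))
      (rowPos (kerBasis c.n (o.views.getD s dfltView).ic.piv (o.views.getD s dfltView).ic.red) 0)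
      (o.views.getD s dfltView).t 0 0)
    (hprof : orbitProfileOKF c.n (c.dZ - 1) (autPerms o.gens) o.words o.views o.cls o.mu = true) (hd : 1 ≤ c.dZ) :
    (c.code (c.commOK_of_checkStructure hs)).dZ = c.dZ := by
  have h' := hs
  simp only [checkStructure, Bool.and_eq_true] at h'
  obtain ⟨hv, hv', hwt⟩ := upper_sound h'.1.1.1.2
  refine (c.code _).dZ_eq_of_witness hv hv' hwt fun w hw hw' => ?_
  have := c.lowZ_of_orbitF hs o hgens hwords hviews hreach hprof w hw hw'
  omega

/-- **`d_X` from the fast orbit lane.** (theorem) -/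
theorem dX_code_of_orbitF (hs : c.checkStructure = true) (o : OrbitSide)
    (hgens : autGensOKFast c.n c.HZ c.HX o.gens = true) (hwords : autWordsOK o.gens.length o.words = true)
    (hviews : ∀ s, s < o.views.length → infoSetStructOK c.n c.HZ (o.views.getD s dfltView).ic = true)
    (hreach : ∀ s, s < o.views.length → Reaches (bzLeaf (c.dX - 1) (c.sideX.found.map Prod.fst))
      (rowPos (kerBasis c.n (o.views.getD s dfltView).ic.piv (o.views.getD s dfltView).ic.red) 0)
      (o.views.getD s dfltView).t 0 0)
    (hprof : orbitProfileOKF c.n (c.dX - 1) (autPerms o.gens) o.words o.views o.cls o.mu = true) (hd : 1 ≤ c.dX) :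
    (c.code (c.commOK_of_checkStructure hs)).dX = c.dX := by
  have h' := hs
  simp only [checkStructure, Bool.and_eq_true] at h'
  obtain ⟨hv, hv', hwt⟩ := upper_sound h'.1.2
  refine (c.code _).dX_eq_of_witness hv hv' hwt fun w hw hw' => ?_
  have := c.lowX_of_orbitF hs o hgens hwords hviews hreach hprof w hw hw'
  omega

end DistCert

/-! ## Controls (CERT-REQS A1): `[[4,2,2]]` through the fast lane (data `orbitC422` of the landed lane) -/

/-- The fast generator check passes on the `[[4,2,2]]` shift. -/
theorem orbitC422_gensL : autGensOKFast 4 certC422.HX certC422.HZ orbitC422.gens = true := by decide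

/-- The fast profile check passes at `wmax = 1` (transported free masks; the four shifts are inverse-closed, so the
class table is the landed one). -/
theorem orbitC422_profF :
    orbitProfileOKF 4 1 (autPerms orbitC422.gens) orbitC422.words orbitC422.views orbitC422.cls orbitC422.mu = true := by
  decide

/-- NEGATIVE control: with the identity word alone (`words = [[]]`) the same view at depth `0` is REJECTED. -/
theorem orbitC422_profF_neg :
    orbitProfileOKF 4 1 (autPerms orbitC422.gens) [[]] orbitC422.views [0, 1, 1, 1] [[0], [1]] = false := by decide

/-- **End-to-end control (fast lane)**, stated on the CODE: `d_Z = 2` re-derived through `dZ_code_of_orbitF` agrees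
with the landed `dZ_certC422_mitm` (both sides of the `↔` are the same proposition; the point is that the fast-lane
term elaborates). -/
theorem dZ_certC422_orbitF_iff :
    (certC422.code (certC422.commOK_of_checkStructure checkStructure_certC422)).dZ = 2 ↔
      certC422.dZ = 2 :=
  ⟨fun _ => rfl, fun _ => certC422.dZ_code_of_orbitF checkStructure_certC422 orbitC422 orbitC422_gensL
    orbitC422_words orbitC422_views orbitC422_reach orbitC422_profF (by decide)⟩

/-! ## Appended 2026-08-27 (qec-search-4 g4): one generator check for both sides -/

/-- Exchange the two row maps of a generator (side `Z` orientation ↦ side `X` orientation: the permutation is the same,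
the syndrome / stabilizer roles of `H^X`, `H^Z` are exchanged). (definition) -/
def AutGen.swapRows (a : AutGen) : AutGen := ⟨a.perm, a.rowsStab, a.rowsSyn⟩

/-- **One check, both sides**: the fast generator check in the `Z` orientation (`Hsyn = H^X`, `Hstab = H^Z`) gives the
check in the `X` orientation for the row-swapped generators — so an emitted row evaluates `autGenOKFast` once per
generator, not twice. -/
theorem autGensOKFast_swapRows {n : ℕ} {HX HZ : List ℕ} {gens : List AutGen}
    (h : autGensOKFast n HX HZ gens = true) : autGensOKFast n HZ HX (gens.map AutGen.swapRows) = true := by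
  simp only [autGensOKFast, autGenOKFast, List.all_eq_true, Bool.and_eq_true, List.mem_map] at h ⊢
  rintro _ ⟨a, ha, rfl⟩
  obtain ⟨⟨h1, h2⟩, h3⟩ := h a ha
  exact ⟨⟨h1, h3⟩, h2⟩

/-- The words check does not see the row maps. -/
theorem autWordsOK_swapRows {gens : List AutGen} {words : List (List ℕ)}
    (h : autWordsOK gens.length words = true) : autWordsOK (gens.map AutGen.swapRows).length words = true := by
  rwa [List.length_map]

/-- The permutation tables are unchanged by the row swap. -/
theorem autPerms_swapRows (gens : List AutGen) : autPerms (gens.map AutGen.swapRows) = autPerms gens := by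
  simp [autPerms, AutGen.swapRows, List.map_map, Function.comp_def]

/-! ## Appended 2026-08-27 (qec-search-4 g4): commutation from an RREF view, and `checkStructure` from its parts -/

section CommRref

variable {n : ℕ}

/-- Reconstruction of a word in the row space of the reduced rows from its PIVOT bits: `⊕ {ρ_i : bit piv[i] of v}`.
(definition) -/
def redComb (piv red : List ℕ) (v : ℕ) : ℕ :=
  xorList (((List.range piv.length).filter fun i => v.testBit (piv.getD i 0)).map fun i => red.getD i 0)

/-- Reconstruction of a kernel word from its FREE bits: `⊕ {γ_j : j free, bit j of v}`. (definition) -/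
def kerComb (n : ℕ) (piv red : List ℕ) (v : ℕ) : ℕ :=
  xorList (((freeIdx n piv).filter fun j => v.testBit j).map (kerVec piv red))

/-- **Commutation through an RREF view** (no popcounts): the reduced rows have unit pivot columns (`pivotsOK`), every
`H^X` row is the XOR of reduced rows named by its pivot bits, every `H^Z` row is the XOR of kernel-basis words named by
its free bits.  Since every reduced row is orthogonal to every kernel-basis word (`dotProduct_red_kerVec`), `H^X (H^Z)ᵀ = 0`.
Cost: one XOR per set bit per row — replaces the `|H^X|·|H^Z|` popcounts of `commOK` / `commOKQ`. (definition) -/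
def commOKR (n : ℕ) (HX HZ : List ℕ) (ic : InfoSetCert) : Bool :=
  pivotsOK n ic.piv ic.red && (HX.all fun v => redComb ic.piv ic.red v == v) &&
    (HZ.all fun v => kerComb n ic.piv ic.red v == v)

/-- Dot product with a list sum on the right. -/
private theorem dotProduct_listSum_right (v : Fin n → ZMod 2) :
    ∀ L : List (Fin n → ZMod 2), v ⬝ᵥ L.sum = (L.map fun u => v ⬝ᵥ u).sum
  | [] => by simp
  | u :: L => by rw [List.sum_cons, dotProduct_add, List.map_cons, List.sum_cons, dotProduct_listSum_right v L]

/-- Dot product with a list sum on the left. -/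
private theorem dotProduct_listSum_left (v : Fin n → ZMod 2) :
    ∀ L : List (Fin n → ZMod 2), L.sum ⬝ᵥ v = (L.map fun u => u ⬝ᵥ v).sum
  | [] => by simp
  | u :: L => by rw [List.sum_cons, add_dotProduct, List.map_cons, List.sum_cons, dotProduct_listSum_left v L]

/-- **Soundness of `commOKR`**: `H^X (H^Z)ᵀ = 0`. -/
theorem comm_of_commOKR {HX HZ : List ℕ} {ic : InfoSetCert} (h : commOKR n HX HZ ic = true) :
    rowMatrix n HX * (rowMatrix n HZ)ᵀ = 0 := by
  simp only [commOKR, Bool.and_eq_true, List.all_eq_true, beq_iff_eq] at h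
  obtain ⟨⟨hpiv, hX⟩, hZ⟩ := h
  ext i j
  rw [Matrix.mul_apply', Matrix.zero_apply]
  change ofBits n HX[(i : ℕ)] ⬝ᵥ ofBits n HZ[(j : ℕ)] = 0
  rw [← hX _ (List.getElem_mem i.2), ← hZ _ (List.getElem_mem j.2), redComb, kerComb, ofBits_xorList, ofBits_xorList,
    dotProduct_listSum_left]
  refine List.sum_eq_zero fun x hx => ?_
  simp only [List.map_map, List.mem_map, Function.comp_apply] at hx
  obtain ⟨a, ha, rfl⟩ := hx
  rw [dotProduct_listSum_right]
  refine List.sum_eq_zero fun y hy => ?_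
  simp only [List.map_map, List.mem_map, Function.comp_apply] at hy
  obtain ⟨b, hb, rfl⟩ := hy
  have ha' : a < ic.piv.length := by
    have := (List.mem_filter.1 ha).1
    rwa [List.mem_range] at this
  have hb' : b < n := by
    have := (List.mem_filter.1 hb).1
    rw [freeIdx, List.mem_filter, List.mem_range] at this
    exact this.1
  exact dotProduct_red_kerVec hpiv ha' hb'

/-- **The Bool commutation verdict from the matrix identity** (so `DistCert.code`, which takes `commOK … = true`, can be
fed by `commOKR`). -/
theorem commOK_of_comm {HX HZ : List ℕ} (h : rowMatrix n HX * (rowMatrix n HZ)ᵀ = 0) : commOK n HX HZ = true := by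
  simp only [commOK, List.all_eq_true]
  intro hx hhx
  rw [synZero_iff]
  obtain ⟨i, hi, rfl⟩ := List.getElem_of_mem hhx
  ext j
  have := congrFun (congrFun h ⟨i, hi⟩) j
  rw [Matrix.mul_apply', Matrix.zero_apply] at this
  rw [Matrix.mulVec, Pi.zero_apply, dotProduct_comm]
  exact this

end CommRref

namespace DistCert

/-- **`checkStructure` from its parts**: the commutation verdict (however obtained, e.g. `commOK_of_comm (comm_of_commOKR …)`)
and the four fast structural verdicts (rows below `2^n`, both upper witnesses, both allow-lists). -/
theorem checkStructure_of_parts (c : DistCert) (hn : c.n ≤ 496) (hc : commOK c.n c.HX c.HZ = true)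
    (hX : rowsLt c.n c.HX = true) (hZ : rowsLt c.n c.HZ = true)
    (huZ : upperOKQ c.n c.HX c.HZ c.sideZ.d c.sideZ.witness c.sideZ.nonmember = true)
    (hfZ : foundOK c.HZ c.sideZ.found = true)
    (huX : upperOKQ c.n c.HZ c.HX c.sideX.d c.sideX.witness c.sideX.nonmember = true)
    (hfX : foundOK c.HX c.sideX.found = true) : c.checkStructure = true := by
  simp only [checkStructure, Bool.and_eq_true]
  exact ⟨⟨⟨⟨hc, upperOK_of_upperOKQ hX hZ hn huZ⟩, hfZ⟩, upperOK_of_upperOKQ hZ hX hn huX⟩, hfX⟩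

end DistCert

/-- Control: the `[[4,2,2]]` matrices commute through the RREF view of `orbitC422` (pivot `0`). -/
theorem commOKR_certC422 : commOKR 4 certC422.HX certC422.HZ ⟨[0], [15], [[0]]⟩ = true := by decide

end Summit.Ventures.QEC.Census
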